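import Mathlib
import HarnessLib
import Summits.PneNP.PneNP.Theorems.CnfIdealGenLengthRankDefectRepresentationsTwoGenerators

/-!
# Rank matching inside a commutant (crux `RankDefectRepresentations` = stmt-PneNP-18923, line `cell-union-merge`; lead g18)

Companion of `…Intertwiner.exists_intertwiner` (conjugation needs EQUAL ranks): an idempotent commuting with a complete
orthogonal system `Q` can be replaced by one of ANY prescribed rank `n₀ ≤ d`, still commuting with every `Q_y`, at rank cost
`|rank E' − n₀|` (`exists_commuting_idempotent_rank_eq`).  With W26 (`rank (E − E') ≤ 16c`, hence `|rank E − rank E'| ≤ 16c`)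
this gives an idempotent commuting with `Q` of rank EXACTLY `rank E` within rank `32c` of `E`, so that the intertwiner lemma
applies (memo `Lines/cell-union-merge-g18.md` §9, the route to AMB with `λ(c) = 2^{O(c)}`).

Proof: in a basis adapted to the refined system `R_{(y,b)} = Q_y · (E' or 1 − E')` every `R_{(y,b)}` and `E'` are diagonal
`0/1` matrices; replace the index set of `E'` by a sub/superset of the right size; diagonal matrices commute.
HONEST FRAMING: linear-algebra tool in the negative lane; P ≠ NP is not moved; F-N2 is a FRONTIER formal rung.
-/

set_option linter.dupNamespace false -- `Summit.PneNP.PneNP.…`: summit = sub-problem name (D-0017)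

namespace Summit.PneNP.PneNP.Theorems.CnfIdealGenLengthRankDefectRepresentationsRankMatching

open Matrix Module
open Summit.PneNP.PneNP.Theorems.CnfIdealGenLengthRankDefectRepresentationsAbsoluteMergePair
  (toMatrix_collectedBasis_idempotent rank_toMatrix_toLin' completeOrthogonalIdempotents_toLin')
open Summit.PneNP.PneNP.Theorems.CnfIdealGenLengthRankDefectRepresentationsTwoGenerators
  (twoCells_idem twoCells_orth twoCells_sum twoCells_comm)
open Summit.PneNP.PneNP.Theorems.CnfIdealGenLengthRankDefectRepresentationsPolyOfAbsoluteMergeLevels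
  (prod_cells_idem prod_cells_orth prod_cells_sum)
open Literature.Algebra.Module.KrullSchmidt (isInternal_range_of_completeOrthogonalIdempotents)

variable {K : Type} [Field K] {d : ℕ}

/-- Rank of a `0/1` diagonal matrix = number of ones. [folklore] -/
theorem rank_diagonal_indicator {σ : Type} [Fintype σ] [DecidableEq σ] (Z : Finset σ) :
    (Matrix.diagonal fun i : σ => if i ∈ Z then (1 : K) else 0).rank = Z.card := by
  classical
  rw [Matrix.rank_diagonal]
  rw [← Fintype.card_coe Z]
  refine Fintype.card_congr (Equiv.subtypeEquiv (Equiv.refl σ) fun i => ?_)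
  simp

/-- Diagonal matrices commute. [folklore] -/
theorem diagonal_comm {σ : Type} [Fintype σ] [DecidableEq σ] (v w : σ → K) :
    Matrix.diagonal v * Matrix.diagonal w = Matrix.diagonal w * Matrix.diagonal v := by
  rw [Matrix.diagonal_mul_diagonal, Matrix.diagonal_mul_diagonal]
  congr 1; funext i; exact mul_comm _ _

/-- **Rank matching inside `Comm(Q)`.**  For a complete orthogonal system of idempotents `Q` and an idempotent `E'`
commuting with every `Q_y`, and any `n₀ ≤ d`: there is an idempotent `E''` commuting with every `Q_y` with `rank E'' = n₀`
and `rank (E' − E'') ≤ (rank E' − n₀) + (n₀ − rank E')` (truncated subtractions: the cost is `|rank E' − n₀|`).  Any field. -/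
theorem exists_commuting_idempotent_rank_eq {Y : Type} [Fintype Y] [DecidableEq Y]
    (Q : Y → Matrix (Fin d) (Fin d) K) (E' : Matrix (Fin d) (Fin d) K) (n₀ : ℕ)
    (hQi : ∀ y, Q y * Q y = Q y) (hQo : ∀ y y', y ≠ y' → Q y * Q y' = 0) (hQs : ∑ y, Q y = 1)
    (hE' : E' * E' = E') (hE'Q : ∀ y, E' * Q y = Q y * E') (hn₀ : n₀ ≤ d) :
    ∃ E'' : Matrix (Fin d) (Fin d) K, E'' * E'' = E'' ∧ (∀ y, E'' * Q y = Q y * E'') ∧ E''.rank = n₀ ∧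
      (E' - E'').rank ≤ (E'.rank - n₀) + (n₀ - E'.rank) := by
  classical
  -- the refined system `R (y, b) = Q_y · (E' | 1 − E')`
  let C2 : Bool → Matrix (Fin d) (Fin d) K := fun b => bif b then E' else 1 - E'
  have hC2i : ∀ b, C2 b * C2 b = C2 b := twoCells_idem E' hE'
  have hC2o : ∀ b b', b ≠ b' → C2 b * C2 b' = 0 := twoCells_orth E' hE'
  have hC2s : ∑ b, C2 b = 1 := twoCells_sum E'
  have hQC2 : ∀ y b, Q y * C2 b = C2 b * Q y := fun y b => (twoCells_comm E' (Q y) (hE'Q y) b).symm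
  let R : Y × Bool → Matrix (Fin d) (Fin d) K := fun p => Q p.1 * C2 p.2
  have hRi : ∀ p, R p * R p = R p := fun p => prod_cells_idem Q C2 hQi hC2i hQC2 p
  have hRo : ∀ p q, p ≠ q → R p * R q = 0 := fun p q h => prod_cells_orth Q C2 hQo hC2o hQC2 p q h
  have hRs : ∑ p, R p = 1 := prod_cells_sum Q C2 hQs hC2s
  have hE'R : E' = ∑ p ∈ (Finset.univ : Finset Y) ×ˢ ({true} : Finset Bool), R p := by
    rw [Finset.sum_product, ]
    simp only [Finset.sum_singleton]
    show E' = ∑ y, Q y * C2 true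
    rw [← Finset.sum_mul, hQs, Matrix.one_mul]; rfl
  have hQR : ∀ y, Q y = ∑ p ∈ ({y} : Finset Y) ×ˢ (Finset.univ : Finset Bool), R p := by
    intro y
    rw [Finset.sum_product, Finset.sum_singleton]
    show Q y = ∑ b, Q y * C2 b
    rw [← Finset.mul_sum, hC2s, Matrix.mul_one]
  -- adapted basis
  have hq := completeOrthogonalIdempotents_toLin' R hRi hRo hRs
  have hint : DirectSum.IsInternal fun p => LinearMap.range (Matrix.toLin' (R p)) :=
    isInternal_range_of_completeOrthogonalIdempotents hq
  let n : Y × Bool → ℕ := fun p => finrank K (LinearMap.range (Matrix.toLin' (R p)))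
  let b := hint.collectedBasis fun p => Module.finBasis K (LinearMap.range (Matrix.toLin' (R p)))
  have hRb : ∀ p, LinearMap.toMatrix b b (Matrix.toLin' (R p)) =
      Matrix.diagonal (fun i : Σ p, Fin (n p) => if i.1 = p then (1 : K) else 0) :=
    fun p => toMatrix_collectedBasis_idempotent hq hint _ p
  -- the change of coordinates
  have hmul : ∀ M N : Matrix (Fin d) (Fin d) K, LinearMap.toMatrix b b (Matrix.toLin' (M * N)) =
      LinearMap.toMatrix b b (Matrix.toLin' M) * LinearMap.toMatrix b b (Matrix.toLin' N) := by
    intro M N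
    rw [Matrix.toLin'_mul, ← Module.End.mul_eq_comp, LinearMap.toMatrix_mul]
  have hsub : ∀ M N : Matrix (Fin d) (Fin d) K, LinearMap.toMatrix b b (Matrix.toLin' (M - N)) =
      LinearMap.toMatrix b b (Matrix.toLin' M) - LinearMap.toMatrix b b (Matrix.toLin' N) := by
    intro M N
    rw [map_sub Matrix.toLin', map_sub (LinearMap.toMatrix b b)]
  have hsum : ∀ (S : Finset (Y × Bool)), LinearMap.toMatrix b b (Matrix.toLin' (∑ p ∈ S, R p)) =
      Matrix.diagonal (fun i : Σ p, Fin (n p) => if i.1 ∈ S then (1 : K) else 0) := by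
    intro S
    rw [map_sum Matrix.toLin', map_sum (LinearMap.toMatrix b b)]
    simp_rw [hRb]
    ext i j
    rw [Matrix.sum_apply]
    simp only [Matrix.diagonal_apply]
    by_cases h : i = j
    · subst h; simp [Finset.sum_ite_eq]
    · simp [h]
  have hinj : Function.Injective fun M : Matrix (Fin d) (Fin d) K => LinearMap.toMatrix b b (Matrix.toLin' M) :=
    (LinearMap.toMatrix b b).injective.comp Matrix.toLin'.injective
  -- the index set of `E'` and its size
  let T : Finset (Σ p : Y × Bool, Fin (n p)) := Finset.univ.filter fun i => i.1.2 = true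
  have hE'b : LinearMap.toMatrix b b (Matrix.toLin' E') =
      Matrix.diagonal (fun i : Σ p, Fin (n p) => if i ∈ T then (1 : K) else 0) := by
    rw [hE'R, hsum]
    congr 1; funext i
    simp only [T, Finset.mem_filter, Finset.mem_univ, true_and, Finset.mem_product, Finset.mem_singleton]
  have hTcard : T.card = E'.rank := by
    rw [← rank_toMatrix_toLin' b E', hE'b, rank_diagonal_indicator]
  have hcarduniv : (Finset.univ : Finset (Σ p : Y × Bool, Fin (n p))).card = d := by
    rw [Finset.card_univ, ← Module.finrank_eq_card_basis b, Module.finrank_fin_fun]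
  -- a set `Z` of the prescribed size, nested with `T`
  obtain ⟨Z, hZ1, hZ2⟩ : ∃ Z : Finset (Σ p : Y × Bool, Fin (n p)), Z.card = n₀ ∧ (T ⊆ Z ∨ Z ⊆ T) := by
    by_cases hle : T.card ≤ n₀
    · obtain ⟨Z, hTZ, -, hZ⟩ := Finset.exists_subsuperset_card_eq (Finset.subset_univ T) hle (by rw [hcarduniv]; exact hn₀)
      exact ⟨Z, hZ, Or.inl hTZ⟩
    · obtain ⟨Z, -, hZT, hZ⟩ := Finset.exists_subsuperset_card_eq (Finset.empty_subset T) (Nat.zero_le n₀) (by omega)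
      exact ⟨Z, hZ, Or.inr hZT⟩
  -- the new idempotent, transported back
  let D : Matrix (Σ p : Y × Bool, Fin (n p)) (Σ p : Y × Bool, Fin (n p)) K :=
    Matrix.diagonal fun i => if i ∈ Z then (1 : K) else 0
  obtain ⟨E'', hE''⟩ : ∃ E'' : Matrix (Fin d) (Fin d) K, LinearMap.toMatrix' (Matrix.toLin b b D) = E'' := ⟨_, rfl⟩
  have hΦ : LinearMap.toMatrix b b (Matrix.toLin' E'') = D := by
    rw [← hE'', Matrix.toLin'_toMatrix', LinearMap.toMatrix_toLin]
  have hDidem : D * D = D := by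
    show Matrix.diagonal _ * Matrix.diagonal _ = Matrix.diagonal _
    rw [Matrix.diagonal_mul_diagonal]
    congr 1; funext i; split_ifs <;> simp
  refine ⟨E'', ?_, fun y => ?_, ?_, ?_⟩
  · apply hinj
    show LinearMap.toMatrix b b (Matrix.toLin' (E'' * E'')) = LinearMap.toMatrix b b (Matrix.toLin' E'')
    rw [hmul, hΦ, hDidem]
  · apply hinj
    show LinearMap.toMatrix b b (Matrix.toLin' (E'' * Q y)) = LinearMap.toMatrix b b (Matrix.toLin' (Q y * E''))
    rw [hmul, hmul, hΦ, hQR y, hsum]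
    exact diagonal_comm _ _
  · rw [← rank_toMatrix_toLin' b E'', hΦ]
    show (Matrix.diagonal fun i => if i ∈ Z then (1 : K) else 0).rank = n₀
    rw [rank_diagonal_indicator, hZ1]
  · rw [← rank_toMatrix_toLin' b, hsub, hΦ, hE'b]
    have e : (Matrix.diagonal fun i : Σ p, Fin (n p) => if i ∈ T then (1 : K) else 0) - D =
        Matrix.diagonal fun i => (if i ∈ T then (1 : K) else 0) - if i ∈ Z then (1 : K) else 0 := by
      show Matrix.diagonal _ - Matrix.diagonal _ = _
      rw [← Matrix.diagonal_sub]
    rw [e, Matrix.rank_diagonal, ← hTcard, ← hZ1]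
    rcases hZ2 with hTZ | hZT
    · -- `T ⊆ Z`: the difference is supported on `Z \ T`
      have hc : Fintype.card {i : Σ p : Y × Bool, Fin (n p) //
          ((if i ∈ T then (1 : K) else 0) - if i ∈ Z then (1 : K) else 0) ≠ 0} = (Z \ T).card := by
        rw [← Fintype.card_coe (Z \ T)]
        refine Fintype.card_congr (Equiv.subtypeEquiv (Equiv.refl _) fun i => ?_)
        simp only [Equiv.refl_apply, Finset.mem_sdiff]
        by_cases h1 : i ∈ T
        · have h2 : i ∈ Z := hTZ h1
          simp [h1, h2]
        · by_cases h2 : i ∈ Z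
          · simp [h1, h2]
          · simp [h1, h2]
      rw [hc, Finset.card_sdiff_of_subset hTZ]
      omega
    · have hc : Fintype.card {i : Σ p : Y × Bool, Fin (n p) //
          ((if i ∈ T then (1 : K) else 0) - if i ∈ Z then (1 : K) else 0) ≠ 0} = (T \ Z).card := by
        rw [← Fintype.card_coe (T \ Z)]
        refine Fintype.card_congr (Equiv.subtypeEquiv (Equiv.refl _) fun i => ?_)
        simp only [Equiv.refl_apply, Finset.mem_sdiff]
        by_cases h1 : i ∈ T
        · by_cases h2 : i ∈ Z
          · simp [h1, h2]
          · simp [h1, h2]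
        · have h2 : i ∉ Z := fun h => h1 (hZT h)
          simp [h1, h2]
      rw [hc, Finset.card_sdiff_of_subset hZT]
      omega

/-- **Rank matching inside `Comm(Q)`, nested form.**  As `exists_commuting_idempotent_rank_eq`, and in addition `E''` is
NESTED with `E'` (`E' ≤ E''` or `E'' ≤ E'` as commuting idempotents), so that the cells of a system containing `E'` can be
re-assembled around `E''`.  Proof identical (the new index set is a sub- or superset of the old one);  For a complete orthogonal system of idempotents `Q` and an idempotent `E'`
commuting with every `Q_y`, and any `n₀ ≤ d`: there is an idempotent `E''` commuting with every `Q_y` with `rank E'' = n₀`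
and `rank (E' − E'') ≤ (rank E' − n₀) + (n₀ − rank E')` (truncated subtractions: the cost is `|rank E' − n₀|`).  Any field. -/
theorem exists_nested_commuting_idempotent_rank_eq {Y : Type} [Fintype Y] [DecidableEq Y]
    (Q : Y → Matrix (Fin d) (Fin d) K) (E' : Matrix (Fin d) (Fin d) K) (n₀ : ℕ)
    (hQi : ∀ y, Q y * Q y = Q y) (hQo : ∀ y y', y ≠ y' → Q y * Q y' = 0) (hQs : ∑ y, Q y = 1)
    (hE' : E' * E' = E') (hE'Q : ∀ y, E' * Q y = Q y * E') (hn₀ : n₀ ≤ d) :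
    ∃ E'' : Matrix (Fin d) (Fin d) K, E'' * E'' = E'' ∧ (∀ y, E'' * Q y = Q y * E'') ∧ E''.rank = n₀ ∧
      (E' - E'').rank ≤ (E'.rank - n₀) + (n₀ - E'.rank) ∧ E' * E'' = E'' * E' ∧
      (E' * E'' = E' ∨ E' * E'' = E'') := by
  classical
  -- the refined system `R (y, b) = Q_y · (E' | 1 − E')`
  let C2 : Bool → Matrix (Fin d) (Fin d) K := fun b => bif b then E' else 1 - E'
  have hC2i : ∀ b, C2 b * C2 b = C2 b := twoCells_idem E' hE'
  have hC2o : ∀ b b', b ≠ b' → C2 b * C2 b' = 0 := twoCells_orth E' hE'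
  have hC2s : ∑ b, C2 b = 1 := twoCells_sum E'
  have hQC2 : ∀ y b, Q y * C2 b = C2 b * Q y := fun y b => (twoCells_comm E' (Q y) (hE'Q y) b).symm
  let R : Y × Bool → Matrix (Fin d) (Fin d) K := fun p => Q p.1 * C2 p.2
  have hRi : ∀ p, R p * R p = R p := fun p => prod_cells_idem Q C2 hQi hC2i hQC2 p
  have hRo : ∀ p q, p ≠ q → R p * R q = 0 := fun p q h => prod_cells_orth Q C2 hQo hC2o hQC2 p q h
  have hRs : ∑ p, R p = 1 := prod_cells_sum Q C2 hQs hC2s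
  have hE'R : E' = ∑ p ∈ (Finset.univ : Finset Y) ×ˢ ({true} : Finset Bool), R p := by
    rw [Finset.sum_product, ]
    simp only [Finset.sum_singleton]
    show E' = ∑ y, Q y * C2 true
    rw [← Finset.sum_mul, hQs, Matrix.one_mul]; rfl
  have hQR : ∀ y, Q y = ∑ p ∈ ({y} : Finset Y) ×ˢ (Finset.univ : Finset Bool), R p := by
    intro y
    rw [Finset.sum_product, Finset.sum_singleton]
    show Q y = ∑ b, Q y * C2 b
    rw [← Finset.mul_sum, hC2s, Matrix.mul_one]
  -- adapted basis
  have hq := completeOrthogonalIdempotents_toLin' R hRi hRo hRs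
  have hint : DirectSum.IsInternal fun p => LinearMap.range (Matrix.toLin' (R p)) :=
    isInternal_range_of_completeOrthogonalIdempotents hq
  let n : Y × Bool → ℕ := fun p => finrank K (LinearMap.range (Matrix.toLin' (R p)))
  let b := hint.collectedBasis fun p => Module.finBasis K (LinearMap.range (Matrix.toLin' (R p)))
  have hRb : ∀ p, LinearMap.toMatrix b b (Matrix.toLin' (R p)) =
      Matrix.diagonal (fun i : Σ p, Fin (n p) => if i.1 = p then (1 : K) else 0) :=
    fun p => toMatrix_collectedBasis_idempotent hq hint _ p
  -- the change of coordinates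
  have hmul : ∀ M N : Matrix (Fin d) (Fin d) K, LinearMap.toMatrix b b (Matrix.toLin' (M * N)) =
      LinearMap.toMatrix b b (Matrix.toLin' M) * LinearMap.toMatrix b b (Matrix.toLin' N) := by
    intro M N
    rw [Matrix.toLin'_mul, ← Module.End.mul_eq_comp, LinearMap.toMatrix_mul]
  have hsub : ∀ M N : Matrix (Fin d) (Fin d) K, LinearMap.toMatrix b b (Matrix.toLin' (M - N)) =
      LinearMap.toMatrix b b (Matrix.toLin' M) - LinearMap.toMatrix b b (Matrix.toLin' N) := by
    intro M N
    rw [map_sub Matrix.toLin', map_sub (LinearMap.toMatrix b b)]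
  have hsum : ∀ (S : Finset (Y × Bool)), LinearMap.toMatrix b b (Matrix.toLin' (∑ p ∈ S, R p)) =
      Matrix.diagonal (fun i : Σ p, Fin (n p) => if i.1 ∈ S then (1 : K) else 0) := by
    intro S
    rw [map_sum Matrix.toLin', map_sum (LinearMap.toMatrix b b)]
    simp_rw [hRb]
    ext i j
    rw [Matrix.sum_apply]
    simp only [Matrix.diagonal_apply]
    by_cases h : i = j
    · subst h; simp [Finset.sum_ite_eq]
    · simp [h]
  have hinj : Function.Injective fun M : Matrix (Fin d) (Fin d) K => LinearMap.toMatrix b b (Matrix.toLin' M) :=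
    (LinearMap.toMatrix b b).injective.comp Matrix.toLin'.injective
  -- the index set of `E'` and its size
  let T : Finset (Σ p : Y × Bool, Fin (n p)) := Finset.univ.filter fun i => i.1.2 = true
  have hE'b : LinearMap.toMatrix b b (Matrix.toLin' E') =
      Matrix.diagonal (fun i : Σ p, Fin (n p) => if i ∈ T then (1 : K) else 0) := by
    rw [hE'R, hsum]
    congr 1; funext i
    simp only [T, Finset.mem_filter, Finset.mem_univ, true_and, Finset.mem_product, Finset.mem_singleton]
  have hTcard : T.card = E'.rank := by
    rw [← rank_toMatrix_toLin' b E', hE'b, rank_diagonal_indicator]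
  have hcarduniv : (Finset.univ : Finset (Σ p : Y × Bool, Fin (n p))).card = d := by
    rw [Finset.card_univ, ← Module.finrank_eq_card_basis b, Module.finrank_fin_fun]
  -- a set `Z` of the prescribed size, nested with `T`
  obtain ⟨Z, hZ1, hZ2⟩ : ∃ Z : Finset (Σ p : Y × Bool, Fin (n p)), Z.card = n₀ ∧ (T ⊆ Z ∨ Z ⊆ T) := by
    by_cases hle : T.card ≤ n₀
    · obtain ⟨Z, hTZ, -, hZ⟩ := Finset.exists_subsuperset_card_eq (Finset.subset_univ T) hle (by rw [hcarduniv]; exact hn₀)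
      exact ⟨Z, hZ, Or.inl hTZ⟩
    · obtain ⟨Z, -, hZT, hZ⟩ := Finset.exists_subsuperset_card_eq (Finset.empty_subset T) (Nat.zero_le n₀) (by omega)
      exact ⟨Z, hZ, Or.inr hZT⟩
  -- the new idempotent, transported back
  let D : Matrix (Σ p : Y × Bool, Fin (n p)) (Σ p : Y × Bool, Fin (n p)) K :=
    Matrix.diagonal fun i => if i ∈ Z then (1 : K) else 0
  obtain ⟨E'', hE''⟩ : ∃ E'' : Matrix (Fin d) (Fin d) K, LinearMap.toMatrix' (Matrix.toLin b b D) = E'' := ⟨_, rfl⟩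
  have hΦ : LinearMap.toMatrix b b (Matrix.toLin' E'') = D := by
    rw [← hE'', Matrix.toLin'_toMatrix', LinearMap.toMatrix_toLin]
  have hDidem : D * D = D := by
    show Matrix.diagonal _ * Matrix.diagonal _ = Matrix.diagonal _
    rw [Matrix.diagonal_mul_diagonal]
    congr 1; funext i; split_ifs <;> simp
  have hTZcomm : E' * E'' = E'' * E' := by
    apply hinj
    show LinearMap.toMatrix b b (Matrix.toLin' (E' * E'')) = LinearMap.toMatrix b b (Matrix.toLin' (E'' * E'))
    rw [hmul, hmul, hΦ, hE'b]
    exact diagonal_comm _ _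
  have hnest : E' * E'' = E' ∨ E' * E'' = E'' := by
    rcases hZ2 with hTZ | hZT
    · left
      apply hinj
      show LinearMap.toMatrix b b (Matrix.toLin' (E' * E'')) = LinearMap.toMatrix b b (Matrix.toLin' E')
      rw [hmul, hΦ, hE'b]
      show Matrix.diagonal _ * Matrix.diagonal _ = Matrix.diagonal _
      rw [Matrix.diagonal_mul_diagonal]
      congr 1; funext i
      by_cases h1 : i ∈ T
      · simp [h1, hTZ h1]
      · simp [h1]
    · right
      apply hinj
      show LinearMap.toMatrix b b (Matrix.toLin' (E' * E'')) = LinearMap.toMatrix b b (Matrix.toLin' E'')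
      rw [hmul, hΦ, hE'b]
      show Matrix.diagonal _ * Matrix.diagonal _ = Matrix.diagonal _
      rw [Matrix.diagonal_mul_diagonal]
      congr 1; funext i
      by_cases h2 : i ∈ Z
      · simp [h2, hZT h2]
      · simp [h2]
  refine ⟨E'', ?_, fun y => ?_, ?_, ?_, hTZcomm, hnest⟩
  · apply hinj
    show LinearMap.toMatrix b b (Matrix.toLin' (E'' * E'')) = LinearMap.toMatrix b b (Matrix.toLin' E'')
    rw [hmul, hΦ, hDidem]
  · apply hinj
    show LinearMap.toMatrix b b (Matrix.toLin' (E'' * Q y)) = LinearMap.toMatrix b b (Matrix.toLin' (Q y * E''))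
    rw [hmul, hmul, hΦ, hQR y, hsum]
    exact diagonal_comm _ _
  · rw [← rank_toMatrix_toLin' b E'', hΦ]
    show (Matrix.diagonal fun i => if i ∈ Z then (1 : K) else 0).rank = n₀
    rw [rank_diagonal_indicator, hZ1]
  · rw [← rank_toMatrix_toLin' b, hsub, hΦ, hE'b]
    have e : (Matrix.diagonal fun i : Σ p, Fin (n p) => if i ∈ T then (1 : K) else 0) - D =
        Matrix.diagonal fun i => (if i ∈ T then (1 : K) else 0) - if i ∈ Z then (1 : K) else 0 := by
      show Matrix.diagonal _ - Matrix.diagonal _ = _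
      rw [← Matrix.diagonal_sub]
    rw [e, Matrix.rank_diagonal, ← hTcard, ← hZ1]
    rcases hZ2 with hTZ | hZT
    · -- `T ⊆ Z`: the difference is supported on `Z \ T`
      have hc : Fintype.card {i : Σ p : Y × Bool, Fin (n p) //
          ((if i ∈ T then (1 : K) else 0) - if i ∈ Z then (1 : K) else 0) ≠ 0} = (Z \ T).card := by
        rw [← Fintype.card_coe (Z \ T)]
        refine Fintype.card_congr (Equiv.subtypeEquiv (Equiv.refl _) fun i => ?_)
        simp only [Equiv.refl_apply, Finset.mem_sdiff]
        by_cases h1 : i ∈ T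
        · have h2 : i ∈ Z := hTZ h1
          simp [h1, h2]
        · by_cases h2 : i ∈ Z
          · simp [h1, h2]
          · simp [h1, h2]
      rw [hc, Finset.card_sdiff_of_subset hTZ]
      omega
    · have hc : Fintype.card {i : Σ p : Y × Bool, Fin (n p) //
          ((if i ∈ T then (1 : K) else 0) - if i ∈ Z then (1 : K) else 0) ≠ 0} = (T \ Z).card := by
        rw [← Fintype.card_coe (T \ Z)]
        refine Fintype.card_congr (Equiv.subtypeEquiv (Equiv.refl _) fun i => ?_)
        simp only [Equiv.refl_apply, Finset.mem_sdiff]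
        by_cases h1 : i ∈ T
        · by_cases h2 : i ∈ Z
          · simp [h1, h2]
          · simp [h1, h2]
        · have h2 : i ∉ Z := fun h => h1 (hZT h)
          simp [h1, h2]
      rw [hc, Finset.card_sdiff_of_subset hZT]
      omega


/-- **W26 with rank preserved.**  An idempotent `E` whose commutators with all unions of a complete orthogonal system `Q` have
rank `≤ c` is within rank `48 c` of an idempotent of the SAME rank commuting with every `Q_y` (W26 `…AbsoluteMergePair`
gives `16c` with a possibly different rank; rank matching repairs the rank at cost `≤ 32c`). -/
theorem exists_commuting_idempotent_near_rank_eq {Y : Type} [Fintype Y] [DecidableEq Y]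
    (E : Matrix (Fin d) (Fin d) K) (Q : Y → Matrix (Fin d) (Fin d) K) (c : ℕ) (hE : E * E = E)
    (hQi : ∀ y, Q y * Q y = Q y) (hQo : ∀ y y', y ≠ y' → Q y * Q y' = 0) (hQs : ∑ y, Q y = 1)
    (hc : ∀ B : Finset Y, (E * (∑ y ∈ B, Q y) - (∑ y ∈ B, Q y) * E).rank ≤ c) :
    ∃ E'' : Matrix (Fin d) (Fin d) K, E'' * E'' = E'' ∧ (∀ y, E'' * Q y = Q y * E'') ∧ E''.rank = E.rank ∧
      (E - E'').rank ≤ 48 * c := by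
  obtain ⟨E', hE'i, hE'Q, hE'r⟩ :=
    Summit.PneNP.PneNP.Theorems.CnfIdealGenLengthRankDefectRepresentationsAbsoluteMergePair.stub_absoluteMergePair
      K d Y E Q c hE hQi hQo hQs hc
  obtain ⟨E'', h1, h2, h3, h4⟩ := exists_commuting_idempotent_rank_eq Q E' E.rank hQi hQo hQs hE'i hE'Q
    (Matrix.rank_le_width E)
  refine ⟨E'', h1, h2, h3, ?_⟩
  -- `|rank E' − rank E| ≤ rank (E − E') ≤ 16c`
  have ha : E.rank ≤ E'.rank + (E - E').rank := by
    have := Summit.PneNP.PneNP.Theorems.CnfIdealGenLengthRankDefectRepresentationsMergeLowerBound.rank_add_le' E' (E - E')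
    rwa [add_sub_cancel] at this
  have hb : E'.rank ≤ E.rank + (E - E').rank := by
    have := Summit.PneNP.PneNP.Theorems.CnfIdealGenLengthRankDefectRepresentationsMergeLowerBound.rank_sub_le' E (E - E')
    rwa [sub_sub_cancel] at this
  have htri := Summit.PneNP.PneNP.Theorems.CnfIdealGenLengthRankDefectRepresentationsPolyOfAbsoluteMergeLevels.rank_sub_triangle
    E E' E''
  omega

end Summit.PneNP.PneNP.Theorems.CnfIdealGenLengthRankDefectRepresentationsRankMatching
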